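import Summits.ValiantsHypothesis.ValiantsHypothesis.Theorems.LacunarySymmetroidMatrixDescartesVSQTriDefs

/-!
# `MatrixDescartes` census — DEFINITIONS of the all-`(m, K)` recursive TRIDIAGONAL «Viro + square splitting» family
# (`ζ_sym(m,K) ≥ (m−1)(3K−6) + K − 1`)

HONEST FRAMING.  Definitions only (val-V1-extremal engine seat val-v1x-eng-6 g2, `--supports stmt-ValiantsHypothesis-18050`);
theorems in `…VSQGenRec` (continuant recurrence), `…VSQGenInv` (the quantitative induction), `…VSQGenLaw` (the law).  Nothing here
bears on the crux `MatrixDescartes` (stmt-18050, asymptotic) or on `VP ≠ VNP`.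

THE FAMILY (`K = n + 2`, `n ≥ 2`; objects `fa, fb, fc, tau, bz, dlt = δ, sg = σ` of `…VSQDefs` / `…VSQTriDefs`).  `genL n B L l` is the
`l`-th letter (`L × L`, symmetric tridiagonal) of the `L`-LEVEL system, defined by recursion on `L`:
`L = 1`: the `1 × 1` letter `(−1)^n c_l B^{−2δ}`;  `L + 2`: first row/column `(a_l, b_l B^{−δ}, 0, …, 0)` bordering
`(−1)^n B^{−σ d_l} · genL (L+1) l` — i.e. the real matrix `GM n B (L+2) t = ∑_l t^{d_l} genL (L+2) l` is
`[[a(t), B^{−δ} b(t) e₁ᵀ], [B^{−δ} b(t) e₁, (−1)^n · GM (L+1) (t/B^σ)]]`: every level runs the `m = 2` programme, `σ = 4n + 4`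
later (in `x = log_B t`) than the previous one, and the last level is the `c`-chain.  `fL n B L t = det (GM n B L t)`
(`fL 0 = 1`).  TEST POINTS `tp n B L j` (`j < 3n(L−1) + n + 2`): for `L + 2` levels, the `3n` level-`0` points of `…VSQDefs.tau`
(`j < 3n`), then `B^σ · tp (L+1) (j − 3n)`; for `L = 1`, the `c`-points `B^{σ − 1 + 2j}`.  EXPECTED SIGNS `ss n L j` and flat-regime
signs `sflat n L`, DOMINANT VALUES `Vv n B L j` and flat values `B^{L·qa}` — the quantities of the induction `…VSQGenInv`:
`2^{−L} Vv ≤ ss · fL(tp) ≤ 2^{L} Vv`.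
[folklore] Viro patchworking data; elementary.
-/

set_option linter.dupNamespace false
set_option autoImplicit false

namespace Summit.ValiantsHypothesis.ValiantsHypothesis.Theorems.LacunarySymmetroidMatrixDescartes.VSQ

open scoped BigOperators

/-- the letters of the `L`-level recursive tridiagonal family. [folklore] -/
noncomputable def genL (n : ℕ) (B : ℝ) : (L : ℕ) → Fin (n + 2) → Matrix (Fin L) (Fin L) ℝ
  | 0 => fun _ => 0
  | 1 => fun l => Matrix.of fun _ _ => (-1) ^ n * scF n l * B ^ (hcF n l - 2 * (dlt n : ℤ))
  | L + 2 => fun l => Matrix.of fun i j =>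
      Fin.cases
        (Fin.cases (saF n l * B ^ haF n l)
          (fun j' => if (j' : ℕ) = 0 then sbF n l * B ^ (hbF n l - (dlt n : ℤ)) else 0) j)
        (fun i' => Fin.cases (if (i' : ℕ) = 0 then sbF n l * B ^ (hbF n l - (dlt n : ℤ)) else 0)
          (fun j' => (-1) ^ n * B ^ (-((sg n : ℤ) * (dF n l : ℤ))) * genL n B (L + 1) l i' j') j) i

/-- the real matrix of the `L`-level system at `t`. [folklore] -/
noncomputable def GM (n : ℕ) (B : ℝ) (L : ℕ) (t : ℝ) : Matrix (Fin L) (Fin L) ℝ := ∑ l, t ^ dF n l • genL n B L l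

/-- its determinant. [folklore] -/
noncomputable def fL (n : ℕ) (B : ℝ) (L : ℕ) (t : ℝ) : ℝ := (GM n B L t).det

/-- number of test points of the `L`-level system: `3n(L−1) + n + 2` (`L ≥ 1`). [folklore] -/
def npts (n : ℕ) : ℕ → ℕ
  | 0 => 0
  | 1 => n + 2
  | L + 2 => 3 * n + npts n (L + 1)

/-- the test points. [folklore] -/
noncomputable def tp (n : ℕ) (B : ℝ) : ℕ → ℕ → ℝ
  | 0, _ => 1
  | 1, j => B ^ ((sg n : ℤ) - 1 + 2 * j)
  | L + 2, j => if j < 3 * n then tau n B j else B ^ (sg n : ℤ) * tp n B (L + 1) (j - 3 * n)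

/-- sign of the `L`-level determinant in the flat regime `t ≤ B^{−1}`: `(−1)^{n(L + (L−1) + ⋯)}`-type, recursively. [folklore] -/
def sflat (n : ℕ) : ℕ → ℝ
  | 0 => 1
  | 1 => (-1) ^ n
  | L + 2 => (-1) ^ n * ((-1) ^ n) ^ (L + 1) * sflat n (L + 1)

/-- expected sign of the `L`-level determinant at its `j`-th test point. [folklore] -/
noncomputable def ss (n : ℕ) : ℕ → ℕ → ℝ
  | 0, _ => 1
  | 1, j => (-1) ^ n * scR n j
  | L + 2, j =>
      if j < 3 * n then
        (if j ≤ n then saR n j * ((-1) ^ n) ^ (L + 1) * sflat n (L + 1)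
         else if (j - n) % 2 = 0 then ((-1) ^ n) ^ (L + 1) * sflat n (L + 1) else -sflat n L)
      else ((-1) ^ n) ^ (L + 1) * ss n (L + 1) (j - 3 * n)

/-- dominant value of the `L`-level determinant at its `j`-th test point (flat value `B^{L·qa}`). [folklore] -/
noncomputable def Vv (n : ℕ) (B : ℝ) : ℕ → ℕ → ℝ
  | 0, _ => 1
  | 1, j => B ^ (ec n j ((sg n : ℤ) - 1 + 2 * j) - 2 * (dlt n : ℤ))
  | L + 2, j =>
      if j < 3 * n then
        (if j ≤ n then B ^ (ea n j (2 * (j : ℤ) - 1)) * B ^ ((L + 1 : ℕ) * qa n)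
         else if (j - n) % 2 = 0 then
           tv B (haF n ⟨n, by omega⟩) (dF n ⟨n, by omega⟩) (bz n B ((j - n) / 2)) * B ^ ((L + 1 : ℕ) * qa n)
         else B ^ (2 * (eb n ((j - n + 1) / 2) ((j : ℤ) + n) - (dlt n : ℤ))) * B ^ ((L : ℕ) * qa n))
      else tv B (haF n (Fin.last (n + 1))) (dF n (Fin.last (n + 1))) (tp n B (L + 2) j) * Vv n B (L + 1) (j - 3 * n)

end Summit.ValiantsHypothesis.ValiantsHypothesis.Theorems.LacunarySymmetroidMatrixDescartes.VSQ
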